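import Summits.ResolutionOfSingularities.ResolutionOfSingularities.Theorems.FrobeniusLadderFInjectiveMacaulayficationP2d4F5Specimen
import Summits.ResolutionOfSingularities.ResolutionOfSingularities.Theorems.FrobeniusLadderFInjectiveMacaulayficationKLocCellRange
import Summits.ResolutionOfSingularities.ResolutionOfSingularities.Theorems.FrobeniusLadderFInjectiveMacaulayficationKLocCellSound
import Summits.ResolutionOfSingularities.ResolutionOfSingularities.Theorems.FrobeniusLadderFInjectiveMacaulayficationNotDvdOfSupport
import Summits.ResolutionOfSingularities.ResolutionOfSingularities.Theorems.FrobeniusLadderFInjectiveMacaulayficationPConeFedderData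
import Summits.ResolutionOfSingularities.ResolutionOfSingularities.Theorems.FrobeniusLadderFInjectiveMacaulayficationE8Char5FiModel
import Summits.ResolutionOfSingularities.ResolutionOfSingularities.Theorems.FrobeniusLadderFInjectiveMacaulayficationLevelTwoBlockTranslate
import Summits.ResolutionOfSingularities.ResolutionOfSingularities.Theorems.FrobeniusLadderFInjectiveMacaulayficationWFixAtNonClosedDimTwo
import HarnessLib

/-!
# THE SPECIMEN PACKAGE OF THE E4″ GERM `G = {ab + w₁³ + w₂³ + w₃³ = 0} ⊂ 𝔸⁵` (char 2, `d = 4`): prime, vertex closed / singular / isolated / of dimension 4 /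
# CM — and ★ FULL (F-pure + CM + domain): a LEGAL base germ of the T″(2,4,·) stub of door v41
# (crux `FInjectiveMacaulayfication` stmt-ResolutionOfSingularities-15315, chain w45a; res-L1-w45a-plan-1 RULINGS R18.19 (3) / R18.20 / R18.22 (1) / R18.26 (2) «(F0)
# `…E4GermSpecimen` GO»; res-L1-w45a-stub-3's typing plan `g9/E4-STEP-TYPING.md` §B; template = `P2d4F5Specimen` (res-L1-w45a-stub-2 g7); seat res-L1-w45a-stub-2 g8)

[OURS · L1 W4.5a] Support file (`--supports stmt-ResolutionOfSingularities-15315 --as helper`); unconditional; replaces the role of NO printed item; NOT a statement of the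
manuscript; AI-written (AI review is weaker than expert review).

`X 0 = a`, `X 1 = b`, `X 2 = w₁`, `X 3 = w₂`, `X 4 = w₃`; `f = ab + w₁³ + w₂³ + w₃³` (res-L1-w45a-idea-1's surviving F-pure singular germ on floor 2 of the τ-tower of P2d4C,
`w₁³+w₂³+w₃³ + xw + w²` after `w′ := x + w`: a cA-type fourfold over the cone on the smooth supersingular Fermat cubic; res-L1-w45a-stub-3 `g9/E4-STEP.md` v1.1, kit j304590;
res-L1-w45a-tri-2 disjoint re-check l.79883); `v` = the origin of `G = Spec k[X]/(f)`, `char k = 2` (any field of characteristic 2 — covers `K = k(s)`).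
* §1 `pderiv_zero_f` (`∂_a f = b`), `pderiv_one_f` (`∂_b f = a`), `pderiv_cube_f` (`∂_{wᵢ} f = wᵢ²`), `constantCoeff_f`, ★ `prime_f` (as `T³ + C(ba + w₂³ + w₃³)` over
  `k[b, a, w₂, w₃]` (`w₁ ↦ T`): Eisenstein-type at `(1, 0, 0, 0)` where the constant vanishes and `∂/∂a = b = 1 ≠ 0`), `regular_off_vertex` (Jacobian: any variable outside `P`
  is — up to a square — a partial derivative outside `P`), `isIntegral_G`;
* §2 the germ binders at `v`: `isClosed_vertex`, `vertex_not_mem_regularLocus`, `ringKrullDim_stalk_vertex = 4`, `regular_of_ne_vertex` / `regular_off_closedPoint_vertex`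
  (ISOLATED), `cmCl_Spec_stalk_vertex`;
* §3 ★ `fullCl_Spec_stalk_vertex : FullCl 2 𝒪_{G,v}` — the term `ab` of `f = f^{p−1}` is square-free with coefficient `1`: ONE thin Fedder cell (`FTL`, `CELLS`, `hcheck` by
  `decide +kernel`, identity matrix as the «chart») through `KLocCellRange.honQuot_of_kLocCells_range` gives the CM + Frobenius-closed clause at EVERY maximal ideal of
  `k[X]/(f)`, hence at `𝔪_v`; with the domain property this is `FullCl 2` of the stalk (`clause_Spec_stalk_of_isMaximal`, `fullCl_Spec_stalk_vertex`). Contrast: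
  `P2d4F5Specimen.p2d4f5_vertex_not_fullCl` (there `f ∈ 𝔪^{[2]}`).
`FTL`/`CELLS` are plain data tables (no instances, no notation); no named facts. [folklore mathematics, OURS as a certificate; cite: Hartshorne1977, I Thm. 5.1;
Matsumura1987, Thm. 17.4; Fedder1983, Prop. 1.7 and Thm. 1.12]
-/

-- single-problem summit: the doubled namespace component is forced
set_option linter.dupNamespace false

noncomputable section

open AlgebraicGeometry CategoryTheory Literature.AlgebraicGeometry.Resolution TopologicalSpace IsLocalRing MvPolynomial

namespace Summit.ResolutionOfSingularities.ResolutionOfSingularities.Theorems.FInjectiveMacaulayfication.E4GermSpecimen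

open Summit.ResolutionOfSingularities.ResolutionOfSingularities.Theorems.FInjectiveMacaulayfication
open SliceableCentre GermForm GermOfGlobalBlowup FCentreE1RungZero

/-! ## §1 Derivatives, primality, regularity off the vertex -/

/-- `∂f/∂a = b`. [folklore] -/
theorem pderiv_zero_f (k : Type) [Field k] (f : MvPolynomial (Fin 5) k)
    (hf : f = X 0 * X 1 + X 2 ^ 3 + X 3 ^ 3 + X 4 ^ 3) : pderiv 0 f = X 1 := by
  rw [hf]
  simp only [map_add, Derivation.leibniz, pderiv_pow, pderiv_X_self, pderiv_X_of_ne (show (1 : Fin 5) ≠ 0 by decide),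
    pderiv_X_of_ne (show (2 : Fin 5) ≠ 0 by decide), pderiv_X_of_ne (show (3 : Fin 5) ≠ 0 by decide),
    pderiv_X_of_ne (show (4 : Fin 5) ≠ 0 by decide), smul_eq_mul, mul_zero, mul_one, add_zero, zero_add]

/-- `∂f/∂b = a`. [folklore] -/
theorem pderiv_one_f (k : Type) [Field k] (f : MvPolynomial (Fin 5) k)
    (hf : f = X 0 * X 1 + X 2 ^ 3 + X 3 ^ 3 + X 4 ^ 3) : pderiv 1 f = X 0 := by
  rw [hf]
  simp only [map_add, Derivation.leibniz, pderiv_pow, pderiv_X_self, pderiv_X_of_ne (show (0 : Fin 5) ≠ 1 by decide),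
    pderiv_X_of_ne (show (2 : Fin 5) ≠ 1 by decide), pderiv_X_of_ne (show (3 : Fin 5) ≠ 1 by decide),
    pderiv_X_of_ne (show (4 : Fin 5) ≠ 1 by decide), smul_eq_mul, mul_zero, mul_one, add_zero]

/-- `∂f/∂wᵢ = 3wᵢ²` (`= wᵢ²` in characteristic 2). [folklore] -/
theorem pderiv_cube_f (k : Type) [Field k] [CharP k 2] (f : MvPolynomial (Fin 5) k)
    (hf : f = X 0 * X 1 + X 2 ^ 3 + X 3 ^ 3 + X 4 ^ 3) (j : Fin 5) (hj : j = 2 ∨ j = 3 ∨ j = 4) :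
    pderiv j f = X j ^ 2 := by
  have h3 : (3 : MvPolynomial (Fin 5) k) = 1 := (FermatCubicConeChar2.two_three k (n := 5)).2
  rw [hf]
  rcases hj with rfl | rfl | rfl
  all_goals
    simp only [map_add, Derivation.leibniz, pderiv_pow, pderiv_X_self, smul_eq_mul, pderiv_X_of_ne (show (0 : Fin 5) ≠ 2 by decide),
      pderiv_X_of_ne (show (1 : Fin 5) ≠ 2 by decide), pderiv_X_of_ne (show (3 : Fin 5) ≠ 2 by decide),
      pderiv_X_of_ne (show (4 : Fin 5) ≠ 2 by decide), pderiv_X_of_ne (show (0 : Fin 5) ≠ 3 by decide),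
      pderiv_X_of_ne (show (1 : Fin 5) ≠ 3 by decide), pderiv_X_of_ne (show (2 : Fin 5) ≠ 3 by decide),
      pderiv_X_of_ne (show (4 : Fin 5) ≠ 3 by decide), pderiv_X_of_ne (show (0 : Fin 5) ≠ 4 by decide),
      pderiv_X_of_ne (show (1 : Fin 5) ≠ 4 by decide), pderiv_X_of_ne (show (2 : Fin 5) ≠ 4 by decide),
      pderiv_X_of_ne (show (3 : Fin 5) ≠ 4 by decide), mul_zero, mul_one, zero_add, add_zero]
    push_cast
    rw [h3]
    ring

/-- `f` has no constant term. [folklore] -/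
theorem constantCoeff_f (k : Type) [Field k] (f : MvPolynomial (Fin 5) k)
    (hf : f = X 0 * X 1 + X 2 ^ 3 + X 3 ^ 3 + X 4 ^ 3) : constantCoeff f = 0 := by
  rw [hf]
  simp [constantCoeff_X]

/-- **`f = ab + w₁³ + w₂³ + w₃³` is PRIME** (any field): as `T³ + C(0)·T + C(ab + w₁³ + w₂³)` over `k[a, b, w₁, w₂]` (`w₃ = X 4 ↦ T` via `finRotate 5`,
exactly as `P2d4F5Specimen.prime_f`), Eisenstein-type at the point `(0, 1, 0, 0)` where the constant `ab + w₁³ + w₂³` vanishes and `∂/∂a = b = 1 ≠ 0`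
(`irreducible_X_pow_add_C_mul_X_add_C`). [folklore] -/
theorem prime_f (k : Type) [Field k] (f : MvPolynomial (Fin 5) k)
    (hf : f = X 0 * X 1 + X 2 ^ 3 + X 3 ^ 3 + X 4 ^ 3) : Prime f := by
  set e : MvPolynomial (Fin 5) k ≃+* Polynomial (MvPolynomial (Fin 4) k) :=
    ((renameEquiv k (_root_.finRotate 5)).trans (finSuccEquiv k 4)).toRingEquiv with he_def
  have hrot4 : (_root_.finRotate 5) (4 : Fin 5) = 0 := by decide
  have hrot : ∀ j : Fin 4, (_root_.finRotate 5) (Fin.castSucc j) = j.succ := by decide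
  have he4 : e (X 4) = Polynomial.X := by
    show finSuccEquiv k 4 (rename _ (X 4)) = _
    rw [rename_X, hrot4]; exact finSuccEquiv_X_zero
  have hej : ∀ j : Fin 4, e (X (Fin.castSucc j)) = Polynomial.C (X j) := fun j => by
    show finSuccEquiv k 4 (rename _ (X (Fin.castSucc j))) = _
    rw [rename_X, hrot j]; exact finSuccEquiv_X_succ (j := j)
  set c : MvPolynomial (Fin 4) k := X 0 * X 1 + X 2 ^ 3 + X 3 ^ 3 with hc
  have hef : e f = Polynomial.X ^ 3 + Polynomial.C (0 : MvPolynomial (Fin 4) k) * Polynomial.X + Polynomial.C c := by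
    rw [hf, map_add, map_add, map_add, map_mul, map_pow, map_pow, map_pow, he4,
      show (0 : Fin 5) = Fin.castSucc (0 : Fin 4) from rfl, show (1 : Fin 5) = Fin.castSucc (1 : Fin 4) from rfl,
      show (2 : Fin 5) = Fin.castSucc (2 : Fin 4) from rfl, show (3 : Fin 5) = Fin.castSucc (3 : Fin 4) from rfl, hej, hej, hej, hej, hc]
    simp only [map_add, map_mul, map_pow, map_zero, zero_mul, add_zero]
    ring
  set a : Fin 4 → k := ![0, 1, 0, 0] with ha
  have hba : MvPolynomial.eval a (0 : MvPolynomial (Fin 4) k) = 0 := map_zero _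
  have hca : MvPolynomial.eval a c = 0 := by
    rw [hc]
    simp only [map_add, map_mul, map_pow, eval_X, ha, Matrix.cons_val_zero, Matrix.cons_val_one]
    simp [Matrix.cons_val]
  have hder : MvPolynomial.eval a (pderiv 0 c) ≠ 0 := by
    have e1 : pderiv 0 c = X 1 := by
      rw [hc, map_add, map_add, Derivation.leibniz, pderiv_X_self, pderiv_X_of_ne (show (1 : Fin 4) ≠ 0 by decide), pderiv_pow,
        pderiv_X_of_ne (show (2 : Fin 4) ≠ 0 by decide), pderiv_pow, pderiv_X_of_ne (show (3 : Fin 4) ≠ 0 by decide)]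
      simp
    rw [e1, eval_X, ha]
    simp
  have hirr : Irreducible (e f) := by
    rw [hef]
    exact Literature.AlgebraicGeometry.Motives.SmoothHypersurface.irreducible_X_pow_add_C_mul_X_add_C (d := 3) (by norm_num) 0 c a hba hca 0 hder
  exact (MulEquiv.prime_iff e).mp hirr.prime

/-- **`(k[X]/(f))_P` is regular at every prime `P ⊉ (ā, b̄, w̄₁, w̄₂, w̄₃)`**: some variable misses `P`; `b ∉ P` ⇒ `∂_a f = b ∉ P`, `a ∉ P` ⇒ `∂_b f = a ∉ P`,
`wᵢ ∉ P` ⇒ `∂_{wᵢ} f = wᵢ² ∉ P` (Jacobian). [cite: Hartshorne1977, I Thm. 5.1] -/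
theorem regular_off_vertex (k : Type) [Field k] [CharP k 2] (f : MvPolynomial (Fin 5) k)
    (hf : f = X 0 * X 1 + X 2 ^ 3 + X 3 ^ 3 + X 4 ^ 3)
    (P : Ideal (MvPolynomial (Fin 5) k ⧸ Ideal.span {f})) [P.IsPrime]
    (hP : ¬ Ideal.span (Set.range fun j : Fin 5 => Ideal.Quotient.mk (Ideal.span {f}) (X j)) ≤ P) :
    IsRegularLocalRing (Localization.AtPrime P) := by
  have hP' : (P.comap (Ideal.Quotient.mk (Ideal.span {f}))).IsPrime := Ideal.comap_isPrime _ _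
  set P' := P.comap (Ideal.Quotient.mk (Ideal.span {f})) with hP'def
  have hex : ∃ j : Fin 5, (X j : MvPolynomial (Fin 5) k) ∉ P' := by
    by_contra hall
    push Not at hall
    apply hP
    rw [Ideal.span_le]
    rintro _ ⟨j, rfl⟩
    exact hall j
  obtain ⟨j, hj⟩ := hex
  by_cases hj0 : j = 0
  · subst hj0
    exact HypersurfaceRegular.stub_hypersurfaceRegularOfPderiv k 5 f 1 P (by rw [pderiv_one_f k f hf]; exact hj)
  by_cases hj1 : j = 1
  · subst hj1
    exact HypersurfaceRegular.stub_hypersurfaceRegularOfPderiv k 5 f 0 P (by rw [pderiv_zero_f k f hf]; exact hj)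
  · have hj234 : j = 2 ∨ j = 3 ∨ j = 4 := by
      fin_cases j <;> simp_all
    exact HypersurfaceRegular.stub_hypersurfaceRegularOfPderiv k 5 f j P
      (by rw [pderiv_cube_f k f hf j hj234]; exact fun h => hj (hP'.mem_of_pow_mem 2 h))

/-- `G` is integral. [folklore] -/
theorem isIntegral_G (k : Type) [Field k] (f : MvPolynomial (Fin 5) k)
    (hf : f = X 0 * X 1 + X 2 ^ 3 + X 3 ^ 3 + X 4 ^ 3) :
    IsIntegral (Spec (.of (MvPolynomial (Fin 5) k ⧸ Ideal.span {f}))) := by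
  haveI := (Ideal.span_singleton_prime (prime_f k f hf).ne_zero).mpr (prime_f k f hf)
  haveI : IsDomain (MvPolynomial (Fin 5) k ⧸ Ideal.span {f}) := Ideal.Quotient.isDomain _
  infer_instance

/-! ## §2 The binders at the vertex -/

/-- (H1) the vertex is closed. [folklore] -/
theorem isClosed_vertex (k : Type) [Field k] (f : MvPolynomial (Fin 5) k)
    (hf : f = X 0 * X 1 + X 2 ^ 3 + X 3 ^ 3 + X 4 ^ 3)
    (v : Spec (.of (MvPolynomial (Fin 5) k ⧸ Ideal.span {f})))
    (hv : v.asIdeal = Ideal.span (Set.range fun j : Fin 5 => Ideal.Quotient.mk (Ideal.span {f}) (X j))) :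
    IsClosed ({v} : Set (Spec (.of (MvPolynomial (Fin 5) k ⧸ Ideal.span {f})))) :=
  DoublePointFermatCubicGerm.isClosed_origin k f (constantCoeff_f k f hf) v hv

/-- (H2) the vertex is NOT regular: `f(0) = 0`, `∇f(0) = 0`. [cite: Hartshorne1977, I Thm. 5.1] -/
theorem vertex_not_mem_regularLocus (k : Type) [Field k] [CharP k 2] (f : MvPolynomial (Fin 5) k)
    (hf : f = X 0 * X 1 + X 2 ^ 3 + X 3 ^ 3 + X 4 ^ 3)
    (v : Spec (.of (MvPolynomial (Fin 5) k ⧸ Ideal.span {f})))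
    (hv : v.asIdeal = Ideal.span (Set.range fun j : Fin 5 => Ideal.Quotient.mk (Ideal.span {f}) (X j))) :
    v ∉ Scheme.regularLocus (Spec (.of (MvPolynomial (Fin 5) k ⧸ Ideal.span {f}))) := by
  classical
  refine not_mem_regularLocus_Spec_of_not_isRegularLocalRing v ?_
  refine not_isRegularLocalRing_localization_of_pderiv_eval_eq_zero (0 : Fin 5 → k) (prime_f k f hf).ne_zero ?_ ?_ v.asIdeal ?_
  · rw [MvPolynomial.eval_zero]
    exact constantCoeff_f k f hf
  · intro i
    by_cases hi0 : i = 0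
    · subst hi0; rw [pderiv_zero_f k f hf, MvPolynomial.eval_X, Pi.zero_apply]
    by_cases hi1 : i = 1
    · subst hi1; rw [pderiv_one_f k f hf, MvPolynomial.eval_X, Pi.zero_apply]
    · have hi : i = 2 ∨ i = 3 ∨ i = 4 := by fin_cases i <;> simp_all
      rw [pderiv_cube_f k f hf i hi, map_pow, MvPolynomial.eval_X, Pi.zero_apply, zero_pow two_ne_zero]
  · rw [hv, DoublePointFermatCubicGerm.comap_origin k f (constantCoeff_f k f hf), MvPolynomial.eval_zero, Fedder.span_range_X_eq_ker]

/-- (H3) `dim 𝒪_{G,v} = 4`. [cite: Matsumura1987, Thm. 13.5] -/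
theorem ringKrullDim_stalk_vertex (k : Type) [Field k] (f : MvPolynomial (Fin 5) k)
    (hf : f = X 0 * X 1 + X 2 ^ 3 + X 3 ^ 3 + X 4 ^ 3)
    (v : Spec (.of (MvPolynomial (Fin 5) k ⧸ Ideal.span {f})))
    (hv : v.asIdeal = Ideal.span (Set.range fun j : Fin 5 => Ideal.Quotient.mk (Ideal.span {f}) (X j))) :
    ringKrullDim ((Spec (.of (MvPolynomial (Fin 5) k ⧸ Ideal.span {f}))).presheaf.stalk v) = (4 : ℕ) := by
  haveI : v.asIdeal.IsMaximal := by
    rw [hv]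
    exact DoublePointFermatCubicGerm.isMaximal_origin k f (constantCoeff_f k f hf)
  rw [ringKrullDim_stalk_Spec_eq]
  exact HypersurfaceLocalDim.stub_hypersurfaceLocalDim k 4 f (prime_f k f hf).ne_zero v.asIdeal

/-- `G` is regular at every point other than the vertex. [cite: Hartshorne1977, I Thm. 5.1] -/
theorem regular_of_ne_vertex (k : Type) [Field k] [CharP k 2] (f : MvPolynomial (Fin 5) k)
    (hf : f = X 0 * X 1 + X 2 ^ 3 + X 3 ^ 3 + X 4 ^ 3)
    (v : Spec (.of (MvPolynomial (Fin 5) k ⧸ Ideal.span {f})))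
    (hv : v.asIdeal = Ideal.span (Set.range fun j : Fin 5 => Ideal.Quotient.mk (Ideal.span {f}) (X j))) :
    ∀ y : Spec (.of (MvPolynomial (Fin 5) k ⧸ Ideal.span {f})), y ⤳ v → y ≠ v →
      y ∈ Scheme.regularLocus (Spec (.of (MvPolynomial (Fin 5) k ⧸ Ideal.span {f}))) := by
  intro y hy hne
  refine FermatCubicConeGerm.mem_regularLocus_Spec_of_isRegularLocalRing y (regular_off_vertex k f hf y.asIdeal fun hle => hne ?_)
  have h2 : y.asIdeal ≤ v.asIdeal := (PrimeSpectrum.le_iff_specializes y v).mpr hy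
  exact PrimeSpectrum.ext (le_antisymm h2 (hv ▸ hle))

/-- (H4) ISOLATED: `Spec 𝒪_{G,v}` is regular off its closed point. [cite: Temkin2008, §2.1] -/
theorem regular_off_closedPoint_vertex (k : Type) [Field k] [CharP k 2] (f : MvPolynomial (Fin 5) k)
    (hf : f = X 0 * X 1 + X 2 ^ 3 + X 3 ^ 3 + X 4 ^ 3)
    (v : Spec (.of (MvPolynomial (Fin 5) k ⧸ Ideal.span {f})))
    (hv : v.asIdeal = Ideal.span (Set.range fun j : Fin 5 => Ideal.Quotient.mk (Ideal.span {f}) (X j))) :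
    ∀ s : Spec ((Spec (.of (MvPolynomial (Fin 5) k ⧸ Ideal.span {f}))).presheaf.stalk v),
      s ≠ closedPoint _ → s ∈ Scheme.regularLocus (Spec ((Spec (.of (MvPolynomial (Fin 5) k ⧸ Ideal.span {f}))).presheaf.stalk v)) :=
  regularLocus_Spec_stalk_of_isolated v (regular_of_ne_vertex k f hf v hv)

/-- (H5) the CM-clause at every point of `Spec 𝒪_{G,v}`. [cite: Matsumura1987, Thm. 17.4 and Thm. 17.8] -/
theorem cmCl_Spec_stalk_vertex (k : Type) [Field k] [CharP k 2] (f : MvPolynomial (Fin 5) k)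
    (hf : f = X 0 * X 1 + X 2 ^ 3 + X 3 ^ 3 + X 4 ^ 3)
    (v : Spec (.of (MvPolynomial (Fin 5) k ⧸ Ideal.span {f})))
    (hv : v.asIdeal = Ideal.span (Set.range fun j : Fin 5 => Ideal.Quotient.mk (Ideal.span {f}) (X j))) :
    ∀ s : Spec ((Spec (.of (MvPolynomial (Fin 5) k ⧸ Ideal.span {f}))).presheaf.stalk v),
      CMCl ((Spec ((Spec (.of (MvPolynomial (Fin 5) k ⧸ Ideal.span {f}))).presheaf.stalk v)).presheaf.stalk s) :=
  cmCl_Spec_stalk_of_isolated v (cmCl_stalk_Spec_of_cmCl_localization v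
    (DoublePointFermatCubicGerm.cmCl_localization_hypersurface k f (prime_f k f hf).ne_zero v)) (regular_of_ne_vertex k f hf v hv)

/-! ## §3 ★ The vertex is FULL: one thin Fedder cell -/

/-- `f = ab + w₁³ + w₂³ + w₃³` as a term list (order of `hf`). -/
def FTL : List (ℤ × (Fin 5 → ℕ)) :=
  [((1 : ℤ), ![1, 1, 0, 0, 0]), ((1 : ℤ), ![0, 0, 3, 0, 0]), ((1 : ℤ), ![0, 0, 0, 3, 0]), ((1 : ℤ), ![0, 0, 0, 0, 3])]

/-- THE THIN FEDDER CELL of `f` in `KLocCellKit.checkKs` currency `(S, R, T, T₀)`: `S = ∅`, `R = [(r, 1)]` with `r = (1,1,0,0,0)` (the `2`-basis class of the term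
`ab` of `f = f^(2-1)`, whose class coefficient is the constant `1`), no `T`, no `T₀`: the identity `1 = 1 · expand 2 (c_r)`. -/
def CELLS : List (Finset (Fin 5) × List ((Fin 5 → ℕ) × List (ℤ × (Fin 5 → ℕ))) × (Fin 5 → List (ℤ × (Fin 5 → ℕ))) × List (ℤ × (Fin 5 → ℕ))) :=
  [((∅ : Finset (Fin 5)), [(![1, 1, 0, 0, 0], [((1 : ℤ), ![0, 0, 0, 0, 0])])], (fun _ => []), [])]

/-- ★ THE FEDDER CERTIFICATE: the cell check passes at `p = 2` (one kernel `decide`). -/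
theorem hcheck : KLocCellKit.checkKs 2 FTL CELLS = true := by decide +kernel

/-- The cell `S = ∅` is present. -/
theorem hS_raw : (∅ : Finset (Fin 5)) ∈ CELLS.map Prod.fst := by decide +kernel

/-- For every variable, a term of `f` free of it whose coefficient class is odd (so no variable divides `f`). -/
theorem hX_raw : ∀ i : Fin 5, ∃ t ∈ FTL, t.2 i = 0 ∧
    ¬ ((2 : ℤ) ∣ ((FTL.filter fun s : ℤ × (Fin 5 → ℕ) => s.2 = t.2).map fun s : ℤ × (Fin 5 → ℕ) => s.1).sum) := by
  decide +kernel

/-- `f` equals the value of its term list `FTL`. -/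
theorem f_eq_evalL (k : Type) [Field k] (f : MvPolynomial (Fin 5) k) (hf : f = X 0 * X 1 + X 2 ^ 3 + X 3 ^ 3 + X 4 ^ 3) :
    f = KLocCellKit.evalL k FTL := by
  rw [hf]
  simp only [KLocCellKit.evalL, FTL, List.map_cons, List.map_nil, List.sum_cons, List.sum_nil, Int.cast_one, PConeFedderData.monomial_five]
  ring

/-- No variable divides `f`; in particular `f ≠ 0`. -/
theorem hX (k : Type) [Field k] [CharP k 2] : ∀ i : Fin 5, ¬ (X i ∣ KLocCellKit.evalL k FTL) := by
  unfold KLocCellKit.evalL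
  exact NotDvdOfSupport.forall_not_X_dvd_evalL 2 FTL hX_raw

/-- **The CM + Frobenius-closed clause at EVERY maximal ideal of `k[X]/(f)`** (the thin cell covers every zero pattern; `J = ∅`).
[cite: Fedder1983, Prop. 1.7 and Thm. 1.12] -/
theorem clause_of_isMaximal (k : Type) [Field k] [CharP k 2] (f : MvPolynomial (Fin 5) k)
    (hf : f = X 0 * X 1 + X 2 ^ 3 + X 3 ^ 3 + X 4 ^ 3)
    (Q : Ideal (MvPolynomial (Fin 5) k ⧸ Ideal.span {f})) [Q.IsMaximal] :
    ∀ d : ℕ, ringKrullDim (Localization.AtPrime Q) = d → ∀ s : Fin d → Localization.AtPrime Q,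
      (Ideal.span (Set.range s)).radical.IsMaximal →
        RingTheory.Sequence.IsWeaklyRegular (Localization.AtPrime Q) (List.ofFn s) ∧
        ∀ y : Localization.AtPrime Q, (∃ e : ℕ, y ^ 2 ^ e ∈ Ideal.span
          ((fun z : Localization.AtPrime Q => z ^ 2 ^ e) ''
            (Ideal.span (Set.range s) : Set (Localization.AtPrime Q)))) → y ∈ Ideal.span (Set.range s) := by
  haveI : Fact (Nat.Prime 2) := ⟨Nat.prime_two⟩
  have hg0 : KLocCellKit.evalL k FTL ≠ 0 := fun h => hX k 0 (by rw [h]; exact dvd_zero _)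
  have hI : Ideal.span (Set.range (![KLocCellKit.evalL k FTL] : Fin 1 → MvPolynomial (Fin 5) k)) = Ideal.span {f} := by
    rw [LevelTwoBlockTranslate.range_vec_one, ← f_eq_evalL k f hf]
  let e : (MvPolynomial (Fin 5) k ⧸ Ideal.span (Set.range (![KLocCellKit.evalL k FTL] : Fin 1 → MvPolynomial (Fin 5) k))) ≃+*
      (MvPolynomial (Fin 5) k ⧸ Ideal.span {f}) := Ideal.quotEquivOfEq hI
  have hon := KLocCellRange.honQuot_of_kLocCells_range 2 k 5 (∅ : Finset (Fin 5)) (1 : Matrix (Fin 5) (Fin 5) ℕ)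
    (![KLocCellKit.evalL k FTL] : Fin 1 → MvPolynomial (Fin 5) k) hg0 (hX k) (CELLS.map Prod.fst)
    (fun T _ => ⟨∅, hS_raw, Finset.empty_subset T⟩)
    (KLocCellKit.klocCells_of_check k 2 FTL CELLS hcheck)
  exact E8Char5FiModel.clause_maximal_of_ringEquiv 2 e (e.symm 0) 0 (e.apply_symm_apply 0)
    (fun Q' hQ' _ => by haveI := hQ'; exact (hon Q' (fun j hj => absurd hj (Finset.notMem_empty j))).2) Q Q.zero_mem

/-- ★ **THE VERTEX OF `G` IS FULL**: `𝒪_{G,v}` is a domain (localisation of the domain `k[X]/(f)`), CM, and every parameter ideal is Frobenius closed —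
the F-pure singular point `ab + w₁³+w₂³+w₃³` is a LEGAL base germ of the T″ stub (singular by `vertex_not_mem_regularLocus`, closed, of dimension 4).
[OURS · certificate; cite: Fedder1983, Thm. 1.12] -/
theorem fullCl_Spec_stalk_vertex (k : Type) [Field k] [CharP k 2] (f : MvPolynomial (Fin 5) k)
    (hf : f = X 0 * X 1 + X 2 ^ 3 + X 3 ^ 3 + X 4 ^ 3)
    (v : Spec (.of (MvPolynomial (Fin 5) k ⧸ Ideal.span {f})))
    (hv : v.asIdeal = Ideal.span (Set.range fun j : Fin 5 => Ideal.Quotient.mk (Ideal.span {f}) (X j))) :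
    FullCl 2 ((Spec (.of (MvPolynomial (Fin 5) k ⧸ Ideal.span {f}))).presheaf.stalk v) := by
  haveI := (Ideal.span_singleton_prime (prime_f k f hf).ne_zero).mpr (prime_f k f hf)
  haveI : IsDomain (MvPolynomial (Fin 5) k ⧸ Ideal.span {f}) := Ideal.Quotient.isDomain _
  haveI : v.asIdeal.IsMaximal := by
    rw [hv]
    exact DoublePointFermatCubicGerm.isMaximal_origin k f (constantCoeff_f k f hf)
  haveI : IsDomain (Localization.AtPrime v.asIdeal) :=
    IsLocalization.isDomain_of_le_nonZeroDivisors _ v.asIdeal.primeCompl_le_nonZeroDivisors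
  have hloc : FullCl 2 (Localization.AtPrime v.asIdeal) := ⟨inferInstance, clause_of_isMaximal k f hf v.asIdeal⟩
  exact WFixAtNonClosedDimTwo.fullCl_of_ringEquiv 2 (Spec.stalkIso (.of _) v).commRingCatIsoToRingEquiv.symm hloc

end Summit.ResolutionOfSingularities.ResolutionOfSingularities.Theorems.FInjectiveMacaulayfication.E4GermSpecimen

end
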